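/-
Copyright (c) 2026 the pub-hodgecm-mathlib formalisation cell (harness21).  Prover seat hodgecm-mathlib-K2E3-p14 (g8), HCML Track B «K2-LIT» (build stream 29),
h413 = `stmt-HodgeConjecture-24833`, line `K2_E3_EllipticInputs`, PART «SC» (SC-an)₂ ∕ M5h₂ cone (L4 LINE-LEAD K2E3-plan (g4), D141 FILE 2): piece (M5d)₂ «THE EXPLICIT
RADIUS OF THEOREM 20's SHELL VANISHING» for `U(σ, Φ_N)(K)` — the `N = 2` (indeed any-rank) twin of this seat's g3 ★ `K2E3SupercuspidalTruncatedCharThm20Radius`, typed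
HYPOTHESIS-FIRST over Theorem 20 on the full level (K2E3-p32 (g0)'s ★-in-flight `K2E3CuspFormCancellationU2LevelOne`) so that the packaging is ★ before its inputs.  2026-09-04.
-/
import Summits.HodgeConjecture.HodgeConjecture.Theorems.K2E3RightInvariantSetIntegralVanishing   -- ★ (f1) p856678 (K2E3-p14 (g3)): `setIntegral_eq_zero_of_forall_setIntegral_mul_eq_zero`, `setIntegral_eq_setIntegral_inter_of_sdiff_eq_zero`, `tendsto_setIntegral_of_forall_sdiff_eq_zero`
import Summits.HodgeConjecture.HodgeConjecture.Theorems.K2E3IwahoriFactorisedLevelU3            -- ★ (T20-c) (K2E3-p21 (g3)) ANY-RANK §4 `forall_v_pow_zero_mul_le_one_of_mem_comap_congruenceGL` (`K_γ ⊆ Ω_0`)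
import Summits.HodgeConjecture.HodgeConjecture.Theorems.F0P3cIwahoriDatumU2                    -- ★ (LH6-p05 (g2)) ANY-RANK `isCompact_level`, `isOpen_level` (`K_γ ∩ U(σ, Φ_N)(K)` is compact open)
import Mathlib.Topology.Compactness.SigmaCompact
import HarnessLib

/-!
# K2_E3 road (h413), socket (SC-an)₂, M5h₂ piece (M5d)₂: THE EXPLICIT RADIUS OF THEOREM 20's SHELL VANISHING — `∫_{Ω n ∖ Ω R} θ(x (y t y⁻¹) x⁻¹) dx = 0`,
# `Θₙ(g) = ∫_{Ω n ∩ Ω R}`, `Θₙ(g) → Θ_R(g)`, `R = m_C + (1 + 2s + 4m_C) + s` — FROM THEOREM 20 ON THE FULL LEVEL `K₁`, any group ∕ any rank, HYPOTHESIS-FIRST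

Cell `pub/hodgecm-mathlib`, Track B «K2-LIT», crux H413 = `stmt-HodgeConjecture-24833` (`--supports … --as helper`, count-neutral); L4 LINE-LEAD K2E3-plan (g4) D141 FILE 2
(2026-09-04T14:57:48Z ∕ 15:07:43Z); chain desk K2E3-p27 (g0); consumers: the (M5h₂) chain (K2E3-p36 RadiusDatum₂ = twin of ★ `K2E3SupercuspidalTruncatedCharRadiusDatum`, which
reads `truncatedCoeff_eq_inter_and_tendsto_of_subset`; K2E3-p32 (g0) Thm20₂).  THEOREMS ONLY (no `def`, no instance, no notation, no named fact, no `sorry`); ★-only imports.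

WHY THIS SHAPE.  At `N = 3` the explicit-radius shell vanishing ★ `K2E3SupercuspidalTruncatedCharThm20Radius.setIntegral_sdiff_heightBall_coeff_conj_eq_zero_of_subset` is ★ [M4]'s
proof with ★ [M3] `cuspForm_cancellation_levelOne_U3` (Theorem 20 on `K₁ = U ∩ GL₃(𝒪)`) feeding the (f1) averaging ★ `setIntegral_eq_zero_of_forall_setIntegral_mul_eq_zero`.  Its
ONLY rank-specific input is Theorem 20 itself; the step «Theorem 20 on `K₁` ⟹ every `K₁`-average of `x ↦ θ(x g x⁻¹)` vanishes on the shell `Ω n ∖ Ω R` ⟹ the shell integral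
vanishes ⟹ `Θₙ(g) = ∫_{Ω n ∩ Ω R}`, `Θₙ(g) → Θ_R(g)`» is pure measure theory on a locally compact group with a compact open subgroup `K₁ ⊆ Ω 0` and a submultiplicative,
inversion-stable compact exhaustion `Ω`.  The `U(1,1)` Theorem 20 is K2E3-p32 (g0)'s ★-in-flight `K2E3CuspFormCancellationU2LevelOne` (D137, over ★ `…U2Torus` p861137), and the
slice cuspidality is K2E3-p37's `K2E3SupercuspOrbitalSliceCuspidalModelTwo`; this file therefore types the packaging ONCE, GENERICALLY, with Theorem 20 as the hypothesis `h20`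
(its literal conclusion for the slice `f`, nothing else), so that the (M5d)₂ heads are ★ NOW and the coefficient form with ★ [M4]'s binder list (`3 ↦ 2`) is a one-line dock
`h20 := fun x hx => cuspForm_cancellation_levelOne_U2 … hx` when D137's files land (no statement of theirs is restated or guessed here).
* §1 (ANY locally compact group `G`, `μ` Haar and right invariant, `K₁ ≤ G` compact open with `K₁ ⊆ Ω 0`, `Ω : CompactExhaustion G` submultiplicative and inversion-stable):
  **`setIntegral_sdiff_eq_zero_of_forall_setIntegral_level_eq_zero`** (`(∀ x ∈ Ω n ∖ Ω R, ∫_{K₁} φ(x k) dμ = 0) ⇒ ∫_{Ω n ∖ Ω R} φ = 0`, the shell is right-`K₁`-invariant and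
  relatively compact); **`setIntegral_sdiff_conj_eq_zero_of_levelOne`** — for `θ : G → E`, `t y : G` with `x ↦ θ(x t x⁻¹)` continuous and THEOREM 20's conclusion
  `h20 : ∀ x ∉ Ω R, ∫_{K₁} θ((x k y) t (x k y)⁻¹) dμ(k) = 0`: **`∫_{Ω n ∖ Ω R} θ(x (y t y⁻¹) x⁻¹) dμ(x) = 0` for every `n`**;
  **`setIntegral_conj_eq_inter_and_tendsto_of_levelOne`** — the two consumer shapes `Θₙ(g) = ∫_{Ω n ∩ Ω R}` (∀ `n`) and `Θₙ(g) → Θ_R(g)` (★ (f1) §4).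
* §2 (`U = U(σ, Φ_N)(K)`, ANY rank, `K` non-archimedean local, `K₁ := K_{γ=1} ∩ U = U ∩ GL_N(𝒪)` — compact open ★ `F0P3cIwahoriDatumU2.isCompact_level` ∕ `isOpen_level`, inside
  `Ω 0` by ★ (T20-c) any-rank §4 read through the height-ball membership `hmem` of ★ `exists_heightBall_compactExhaustion`):
  **`setIntegral_sdiff_heightBall_conj_eq_zero_of_levelOne`**, **`truncated_conj_eq_inter_and_tendsto_of_levelOne`** at the radius `R = m_C + (1 + 2s + 4m_C) + s` of ★ [M3]
  (`= 5m_C + 3s + 1`, ★ `K2E3SupercuspidalTruncatedCharThm20Radius.radius_eq` — not restated), i.e. the (M5d) heads with ★ [M4]'s integrand `θ(x (y t y⁻¹) x⁻¹)` and Theorem 20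
  as `h20`.  DOCK (when ★): `θ := fun g => B u' (ρ g u)`, `h20 := fun x hx => K2E3CuspFormCancellationU2LevelOne.cuspForm_cancellation_levelOne_U2 … (slice cusp form ★ p37) hx`.
[HarishChandra1970, Part VII §2 Theorem 20 p. 70; §3 p. 71 eq. (1), (ii), p. 72]

HONEST LABEL: HC_CM is proved only modulo the 7 printed citations (2 remaining named inputs: hLiu418 = stmt-HodgeConjecture-24832, h413 = stmt-HodgeConjecture-24833)
until rung 0 closes; count-neutral helper ((SC-an)₂ NOT ★; Theorem 20 for `U(1,1)` is the hypothesis `h20` here, paid by D137).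

## References
* [HarishChandra1970] Harish-Chandra (notes by G. van Dijk), *Harmonic Analysis on Reductive p-adic Groups*, LNM 162 (1970), Part VII §2 Theorem 20 p. 70;
  §3 p. 71 eq. (1) and (ii), p. 72 (`Ω(γ)`, `c₁(1+|λ(γ)|)²`).
* [Folland1995] G. B. Folland, *A Course in Abstract Harmonic Analysis* (1995), §2.4, §2.6 (right invariance, Fubini on groups).
* [Casselman1995] W. Casselman, *Introduction to the theory of admissible representations of `p`-adic reductive groups* (1995 notes), §1.4, Prop. 1.4.4 (`K_γ` compact open).
* [Rogawski1990] J. D. Rogawski, *Automorphic Representations of Unitary Groups in Three Variables*, Ann. of Math. Stud. 123 (1990), §1.10 p. 9, §4.9 p. 54.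
-/

set_option autoImplicit false
-- the mandated namespace repeats the single-problem summit's segment (`HodgeConjecture.HodgeConjecture`)
set_option linter.dupNamespace false

noncomputable section

open MeasureTheory Measure Set Filter Topology
open scoped NNReal ENNReal Pointwise Matrix MatrixGroups WithZero
open ValuativeRel
open Literature.NumberTheory.Automorphic Literature.NumberTheory.Automorphic.UnitaryGroup

namespace Summit.HodgeConjecture.HodgeConjecture.Cruxes.H413.K2E3SupercuspidalTruncatedCharThm20RadiusTwo

/-! ## §1 Any locally compact group: Theorem 20 on a compact open level ⟹ shell vanishing ⟹ the two truncation shapes -/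

section Generic

variable {G : Type*} [Group G] [TopologicalSpace G] [IsTopologicalGroup G] [MeasurableSpace G] [BorelSpace G] [T2Space G]
  [LocallyCompactSpace G] [SecondCountableTopology G]
  (μ : Measure G) [μ.IsHaarMeasure] [μ.IsMulRightInvariant]
  {E : Type*} [NormedAddCommGroup E] [NormedSpace ℝ E] [CompleteSpace E]
  (K₁ : Subgroup G) (hK₁c : IsCompact (K₁ : Set G)) (hK₁o : IsOpen (K₁ : Set G))
  (Ω : CompactExhaustion G) (hK₁Ω : (K₁ : Set G) ⊆ Ω 0)
  (hinv : ∀ (m : ℕ) (g : G), g ∈ Ω m → g⁻¹ ∈ Ω m)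
  (hmul : ∀ (a b : ℕ) (g h : G), g ∈ Ω a → h ∈ Ω b → g * h ∈ Ω (a + b))

include hK₁c hK₁o hK₁Ω hinv hmul in
/-- **THE SHELL `Ω n ∖ Ω R` IS RIGHT-`K₁`-INVARIANT AND RELATIVELY COMPACT, SO ITS INTEGRAL VANISHES WHEN ALL ITS `K₁`-AVERAGES DO** (any locally compact group; `K₁ ⊆ Ω 0`
compact open, `Ω` a submultiplicative inversion-stable compact exhaustion, `μ` Haar and right invariant, `φ` continuous): if `∫_{K₁} φ(x k) dμ(k) = 0` for every `x` in the shell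
then `∫_{Ω n ∖ Ω R} φ dμ = 0` — ★ (f1) `setIntegral_eq_zero_of_forall_setIntegral_mul_eq_zero` with `S·K₁ ⊆ S` from `Ω n · Ω 0 ⊆ Ω n` and `Ω R · Ω 0 ⊆ Ω R`.
[cite: HarishChandra1970, Part VII §3 p. 71 eq. (1)] [cite: Folland1995, §2.6] -/
theorem setIntegral_sdiff_eq_zero_of_forall_setIntegral_level_eq_zero (φ : G → E) (hφ : Continuous φ) (R n : ℕ)
    (h0 : ∀ x ∈ Ω n \ Ω R, ∫ k in (K₁ : Set G), φ (x * k) ∂μ = 0) :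
    ∫ x in Ω n \ Ω R, φ x ∂μ = 0 := by
  have hSm : MeasurableSet (Ω n \ Ω R) := (Ω.isCompact n).measurableSet.diff (Ω.isCompact R).measurableSet
  have hSc : IsCompact (closure (Ω n \ Ω R)) := (Ω.isCompact n).closure_of_subset sdiff_subset
  have hSK : ∀ x ∈ Ω n \ Ω R, ∀ k ∈ K₁, x * k ∈ Ω n \ Ω R := by
    intro x hx k hk
    refine ⟨by simpa using hmul n 0 x k hx.1 (hK₁Ω hk), fun hxk => hx.2 ?_⟩
    simpa using hmul R 0 (x * k) k⁻¹ hxk (hinv 0 k (hK₁Ω hk))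
  exact K2E3RightInvariantSetIntegralVanishing.setIntegral_eq_zero_of_forall_setIntegral_mul_eq_zero μ K₁ hK₁c
    (hK₁o.measure_ne_zero μ ⟨1, K₁.one_mem⟩) hSm hSc hSK φ hφ h0

include hK₁c hK₁o hK₁Ω hinv hmul in
/-- **THEOREM 20 ON `K₁` ⟹ THE SHELL VANISHING OF THE CONJUGATED CLASS INTEGRAND** (any locally compact group).  Let `θ : G → E`, `t y : G` with the slice `x ↦ θ(x t x⁻¹)`
continuous, and suppose Theorem 20's conclusion for the slice `f(z) = θ(z t z⁻¹)` at the conjugator `y`: `h20 : ∀ x ∉ Ω R, ∫_{K₁} f(x k y) dμ(k) = 0`.  Then for every `n`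
**`∫_{Ω n ∖ Ω R} θ(x (y t y⁻¹) x⁻¹) dμ(x) = 0`** (the integrand is `f(x y)`, its `K₁`-average at `x` is `∫_{K₁} f(x k y)`; §1 above).  This is the step of ★ [M4] ∕ ★ (M5d) after
Theorem 20, typed once for all ranks. [cite: HarishChandra1970, Part VII §2 Theorem 20 p. 70; §3 p. 71 eq. (1)] -/
theorem setIntegral_sdiff_conj_eq_zero_of_levelOne (θ : G → E) (t y : G) (hθ : Continuous fun x : G => θ (x * t * x⁻¹)) (R n : ℕ)
    (h20 : ∀ x : G, x ∉ Ω R → ∫ k in (K₁ : Set G), θ (x * k * y * t * (x * k * y)⁻¹) ∂μ = 0) :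
    ∫ x in Ω n \ Ω R, θ (x * (y * t * y⁻¹) * x⁻¹) ∂μ = 0 := by
  have hφ : Continuous fun z : G => θ (z * (y * t * y⁻¹) * z⁻¹) := by
    have heq : (fun z : G => θ (z * (y * t * y⁻¹) * z⁻¹)) = (fun x : G => θ (x * t * x⁻¹)) ∘ fun z : G => z * y := by
      funext z
      simp only [Function.comp_apply]
      congr 1
      group
    rw [heq]
    exact hθ.comp (continuous_id.mul continuous_const)
  refine setIntegral_sdiff_eq_zero_of_forall_setIntegral_level_eq_zero μ K₁ hK₁c hK₁o Ω hK₁Ω hinv hmul _ hφ R n fun x hx => ?_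
  rw [← h20 x hx.2]
  refine setIntegral_congr_fun hK₁o.measurableSet fun k _ => ?_
  congr 1
  group

include hK₁c hK₁o hK₁Ω hinv hmul in
/-- **THE TWO CONSUMER SHAPES FROM THEOREM 20 ON `K₁`** (any locally compact group; same data as `setIntegral_sdiff_conj_eq_zero_of_levelOne`): with `g = y t y⁻¹`,
`Θₙ(g) := ∫_{Ω n} θ(x g x⁻¹) dμ(x)` satisfies `Θₙ(g) = ∫_{Ω n ∩ Ω R} θ(x g x⁻¹) dμ` for every `n` (the `hcanc` shape with `Bset g := Ω R`) and `Θₙ(g) → Θ_R(g)` (the `hlim` shape) —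
★ (f1) §4 on the shell vanishing. [cite: HarishChandra1970, Part VII §3 p. 71 eq. (1), p. 72] -/
theorem setIntegral_conj_eq_inter_and_tendsto_of_levelOne (θ : G → E) (t y : G) (hθ : Continuous fun x : G => θ (x * t * x⁻¹)) (R : ℕ)
    (h20 : ∀ x : G, x ∉ Ω R → ∫ k in (K₁ : Set G), θ (x * k * y * t * (x * k * y)⁻¹) ∂μ = 0) :
    (∀ n : ℕ, ∫ x in Ω n, θ (x * (y * t * y⁻¹) * x⁻¹) ∂μ = ∫ x in Ω n ∩ Ω R, θ (x * (y * t * y⁻¹) * x⁻¹) ∂μ) ∧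
      Tendsto (fun n : ℕ => ∫ x in Ω n, θ (x * (y * t * y⁻¹) * x⁻¹) ∂μ) atTop (𝓝 (∫ x in Ω R, θ (x * (y * t * y⁻¹) * x⁻¹) ∂μ)) := by
  have hR : ∀ n : ℕ, ∫ x in Ω n \ Ω R, θ (x * (y * t * y⁻¹) * x⁻¹) ∂μ = 0 := fun n =>
    setIntegral_sdiff_conj_eq_zero_of_levelOne μ K₁ hK₁c hK₁o Ω hK₁Ω hinv hmul θ t y hθ R n h20
  have hφ : Continuous fun z : G => θ (z * (y * t * y⁻¹) * z⁻¹) := by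
    have heq : (fun z : G => θ (z * (y * t * y⁻¹) * z⁻¹)) = (fun x : G => θ (x * t * x⁻¹)) ∘ fun z : G => z * y := by
      funext z
      simp only [Function.comp_apply]
      congr 1
      group
    rw [heq]
    exact hθ.comp (continuous_id.mul continuous_const)
  have hmeas : ∀ n, MeasurableSet (Ω n) := fun n => (Ω.isCompact n).measurableSet
  have hint : ∀ n, IntegrableOn (fun z : G => θ (z * (y * t * y⁻¹) * z⁻¹)) (Ω n) μ := fun n =>
    hφ.continuousOn.integrableOn_compact (Ω.isCompact n)
  exact ⟨K2E3RightInvariantSetIntegralVanishing.setIntegral_eq_setIntegral_inter_of_sdiff_eq_zero μ Ω hmeas R _ hint hR,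
    K2E3RightInvariantSetIntegralVanishing.tendsto_setIntegral_of_forall_sdiff_eq_zero μ Ω (fun _ _ h => Ω.subset h) hmeas R _ hint hR⟩

end Generic

/-! ## §2 `U = U(σ, Φ_N)(K)`, any rank: the level `K₁ = U ∩ GL_N(𝒪)` and the radius `R = m_C + (1 + 2s + 4m_C) + s` of ★ [M3] -/

section Model

variable {K : Type*} [Field K] [Valued K ℤᵐ⁰] [ValuativeRel K] [(Valued.v : Valuation K ℤᵐ⁰).Compatible] [IsNonarchimedeanLocalField K]
  (σ : K →+* K) (hσc : Continuous σ) {N : ℕ} {J : Matrix (Fin N) (Fin N) K}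
  [MeasurableSpace ↥(unitaryGroupOfForm σ J)] [BorelSpace ↥(unitaryGroupOfForm σ J)]
  [SecondCountableTopology ↥(unitaryGroupOfForm σ J)] [LocallyCompactSpace ↥(unitaryGroupOfForm σ J)]
  (μ : Measure ↥(unitaryGroupOfForm σ J)) [μ.IsHaarMeasure] [μ.IsMulRightInvariant]
  (ϖ : K) (Ω : CompactExhaustion ↥(unitaryGroupOfForm σ J))
  (hmem : ∀ (m : ℕ) (g : ↥(unitaryGroupOfForm σ J)), g ∈ Ω m ↔
    (∀ i j, Valued.v (ϖ ^ m * ((g : GL (Fin N) K) : Matrix (Fin N) (Fin N) K) i j) ≤ 1) ∧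
      ∀ i j, Valued.v (ϖ ^ m * (((g : GL (Fin N) K)⁻¹ : GL (Fin N) K) : Matrix (Fin N) (Fin N) K) i j) ≤ 1)
  (hinv : ∀ (m : ℕ) (g : ↥(unitaryGroupOfForm σ J)), g ∈ Ω m → g⁻¹ ∈ Ω m)
  (hmul : ∀ (a b : ℕ) (g h : ↥(unitaryGroupOfForm σ J)), g ∈ Ω a → h ∈ Ω b → g * h ∈ Ω (a + b))
  {E : Type*} [NormedAddCommGroup E] [NormedSpace ℝ E] [CompleteSpace E]

include hσc hmem hinv hmul in
/-- **(M5d), ANY RANK, HYPOTHESIS-FIRST: THE SHELL VANISHING WITH EXPLICIT RADIUS** on `U = U(σ, Φ_N)(K)` (`K` non-archimedean local, `μ` Haar and right invariant, `Ω` the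
height-ball exhaustion through `hmem`∕`hinv`∕`hmul`).  For `θ : U → E` with continuous slice `x ↦ θ(x t x⁻¹)`, a conjugator `y`, and THEOREM 20 ON `K₁ = U ∩ GL_N(𝒪)` for that slice
at the radius `R = m_C + (1 + 2s + 4m_C) + s` (`h20`, the literal conclusion of ★ [M3] `cuspForm_cancellation_levelOne_U3` ∕ D137's `…_U2` for `f(z) = θ(z t z⁻¹)`):
**`∫_{Ω n ∖ Ω R} θ(x (y t y⁻¹) x⁻¹) dμ(x) = 0`** for every `n`.  (`K₁` is compact open ★ `F0P3cIwahoriDatumU2.isCompact_level`∕`isOpen_level` and `⊆ Ω 0` ★ (T20-c) §4; then §1.)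
[cite: HarishChandra1970, Part VII §2 Theorem 20 p. 70; §3 p. 71 eq. (1), (ii)] [cite: Casselman1995, §1.4 Prop. 1.4.4] -/
theorem setIntegral_sdiff_heightBall_conj_eq_zero_of_levelOne (θ : ↥(unitaryGroupOfForm σ J) → E) (t y : ↥(unitaryGroupOfForm σ J))
    (hθ : Continuous fun x : ↥(unitaryGroupOfForm σ J) => θ (x * t * x⁻¹)) {mC s : ℕ} (n : ℕ)
    (h20 : ∀ x : ↥(unitaryGroupOfForm σ J), x ∉ Ω (mC + (1 + 2 * s + 4 * mC) + s) →
      ∫ k in (((congruenceGL N (1 : ValueGroupWithZero K)).comap (unitaryGroupOfForm σ J).subtype : Subgroup ↥(unitaryGroupOfForm σ J)) :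
        Set ↥(unitaryGroupOfForm σ J)), θ (x * k * y * t * (x * k * y)⁻¹) ∂μ = 0) :
    ∫ x in Ω n \ Ω (mC + (1 + 2 * s + 4 * mC) + s), θ (x * (y * t * y⁻¹) * x⁻¹) ∂μ = 0 := by
  haveI : T2Space K := (Literature.NumberTheory.GaloisRepresentations.IsNonarchimedeanLocalField.isLocalField K).toT2Space
  have hK₁c := F0P3cIwahoriDatumU2.isCompact_level (J := J) σ hσc (1 : ValueGroupWithZero K)
  have hK₁o := F0P3cIwahoriDatumU2.isOpen_level (J := J) σ (one_ne_zero : (1 : ValueGroupWithZero K) ≠ 0)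
  have hK₁Ω : (((congruenceGL N (1 : ValueGroupWithZero K)).comap (unitaryGroupOfForm σ J).subtype : Subgroup ↥(unitaryGroupOfForm σ J)) :
      Set ↥(unitaryGroupOfForm σ J)) ⊆ Ω 0 := fun k hk =>
    (hmem 0 k).2 (K2E3IwahoriFactorisedLevelU3.forall_v_pow_zero_mul_le_one_of_mem_comap_congruenceGL σ ϖ hk)
  exact setIntegral_sdiff_conj_eq_zero_of_levelOne μ _ hK₁c hK₁o Ω hK₁Ω hinv hmul θ t y hθ _ n h20

include hσc hmem hinv hmul in
/-- **(M5d), ANY RANK, HYPOTHESIS-FIRST: THE TWO CONSUMER SHAPES WITH EXPLICIT RADIUS** (same data): with `R := m_C + (1 + 2s + 4m_C) + s` and `g = y t y⁻¹`,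
`Θₙ(g) = ∫_{Ω n ∩ Ω R} θ(x g x⁻¹) dμ` for every `n` (the `hcanc` shape of ★ `K2E3SupercuspidalTruncatedCharDominationOfBricks` with `Bset g := Ω R`) and `Θₙ(g) → Θ_R(g)` (the `hlim` shape)
— the statement ★ `K2E3SupercuspidalTruncatedCharRadiusDatum` reads at `N = 3`, now for every rank and modulo Theorem 20 only. [cite: HarishChandra1970, Part VII §3 p. 71 eq. (1), p. 72] -/
theorem truncated_conj_eq_inter_and_tendsto_of_levelOne (θ : ↥(unitaryGroupOfForm σ J) → E) (t y : ↥(unitaryGroupOfForm σ J))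
    (hθ : Continuous fun x : ↥(unitaryGroupOfForm σ J) => θ (x * t * x⁻¹)) {mC s : ℕ}
    (h20 : ∀ x : ↥(unitaryGroupOfForm σ J), x ∉ Ω (mC + (1 + 2 * s + 4 * mC) + s) →
      ∫ k in (((congruenceGL N (1 : ValueGroupWithZero K)).comap (unitaryGroupOfForm σ J).subtype : Subgroup ↥(unitaryGroupOfForm σ J)) :
        Set ↥(unitaryGroupOfForm σ J)), θ (x * k * y * t * (x * k * y)⁻¹) ∂μ = 0) :
    (∀ n : ℕ, ∫ x in Ω n, θ (x * (y * t * y⁻¹) * x⁻¹) ∂μ =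
        ∫ x in Ω n ∩ Ω (mC + (1 + 2 * s + 4 * mC) + s), θ (x * (y * t * y⁻¹) * x⁻¹) ∂μ) ∧
      Tendsto (fun n : ℕ => ∫ x in Ω n, θ (x * (y * t * y⁻¹) * x⁻¹) ∂μ) atTop
        (𝓝 (∫ x in Ω (mC + (1 + 2 * s + 4 * mC) + s), θ (x * (y * t * y⁻¹) * x⁻¹) ∂μ)) := by
  haveI : T2Space K := (Literature.NumberTheory.GaloisRepresentations.IsNonarchimedeanLocalField.isLocalField K).toT2Space
  have hK₁c := F0P3cIwahoriDatumU2.isCompact_level (J := J) σ hσc (1 : ValueGroupWithZero K)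
  have hK₁o := F0P3cIwahoriDatumU2.isOpen_level (J := J) σ (one_ne_zero : (1 : ValueGroupWithZero K) ≠ 0)
  have hK₁Ω : (((congruenceGL N (1 : ValueGroupWithZero K)).comap (unitaryGroupOfForm σ J).subtype : Subgroup ↥(unitaryGroupOfForm σ J)) :
      Set ↥(unitaryGroupOfForm σ J)) ⊆ Ω 0 := fun k hk =>
    (hmem 0 k).2 (K2E3IwahoriFactorisedLevelU3.forall_v_pow_zero_mul_le_one_of_mem_comap_congruenceGL σ ϖ hk)
  exact setIntegral_conj_eq_inter_and_tendsto_of_levelOne μ _ hK₁c hK₁o Ω hK₁Ω hinv hmul θ t y hθ _ h20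

end Model

end Summit.HodgeConjecture.HodgeConjecture.Cruxes.H413.K2E3SupercuspidalTruncatedCharThm20RadiusTwo

end
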